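import Literature.Analysis.FluidPDE.TorusVorticityTensorTransport
import Literature.Analysis.FluidPDE.PassiveScalarForcedClassicalEntropy
import HarnessLib

/-!
# Navier–Stokes on `T^d`: every vorticity component is a forced passive scalar of its own
# velocity, so the co-signed flux `∫ (ω·e)⁺` is raised only by stretching–tilting (and the curl
# of the force) — never by viscosity

Topic `Literature/Analysis/FluidPDE` (theorems only; no definitions, no named facts). The
three-dimensional sequel of `TorusPlanarVorticityCoSignedFlux.lean` (planar case: no source). For a
classical solution `(u, p)` of the forced incompressible Navier–Stokes system on `T^d × [a, b]`
(`Torus.IsClassicalNSSolutionOn (Icc a b) ν f u p`) and indices `i, j`, the vorticity-tensor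
entry `Wᵢⱼ = (∂ᵢu)ⱼ − (∂ⱼu)ᵢ` (`torusVorticityTensor`; on `T³` the entries `W₁₂, W₂₀, W₀₁` are
the Cartesian components of `ω = ∇ × u`) satisfies, by the tree's vorticity-tensor transport
identity `IsClassicalNSSolutionOn.timeDerivWithin_torusVorticityTensor` (Majda–Bertozzi 2002,
§1.4 (1.31), `DΩ/Dt + Ω𝒟 + 𝒟Ω = νΔΩ`, with force):

* `…isClassicalScalarTransportForcedOn_torusVorticityTensor` — `Wᵢⱼ` is a classical solution of
  the FORCED passive-scalar equation `∂ₜWᵢⱼ + u·∇Wᵢⱼ = νΔWᵢⱼ + sᵢⱼ` driven by its own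
  divergence-free velocity, with source the stretching–tilting term plus the curl of the force,
  `sᵢⱼ = −(∑ₖ ∂ᵢuₖ∂ₖuⱼ − ∑ₖ ∂ⱼuₖ∂ₖuᵢ) + (∂ᵢfⱼ − ∂ⱼfᵢ)` (any dimension `d`);
* on `T³` (`…isClassicalScalarTransportForcedOn_vorticity`), for divergence-free `u` the source of
  `ωₐ = W_{a+1,a+2}` is the familiar `((ω·∇)u)ₐ + (∇ × f)ₐ = ∑ₖ ωₖ ∂ₖuₐ + (∂_{a+1}f_{a+2} − ∂_{a+2}f_{a+1})`
  (Majda–Bertozzi 2002, (1.32)–(1.33): `Dω/Dt = (ω·∇)u + νΔω (+ ∇ × f)`, read componentwise);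
* hence, by the sourced renormalised balance of classical passive scalars
  (`PassiveScalarForcedClassicalEntropy.lean`; DiPerna–Lions 1989 §II.3, Gallay–Wayne 2005
  Lemma 3.1 with a right-hand side), for `ν ≥ 0` and `a ≤ t ≤ b`:
  `…hasDerivWithinAt_integral_comp_torusVorticityTensor` —
  `d/dt ∫ β(Wᵢⱼ) = −ν ∫ β″(Wᵢⱼ)‖∇Wᵢⱼ‖² + ∫ β′(Wᵢⱼ) sᵢⱼ` for smooth `β`;
  `…integral_posPart_torusVorticityTensor_sub_le` — **`∫ Wᵢⱼ(t)⁺ − ∫ Wᵢⱼ(a)⁺ ≤ ∫ₐᵗ ∫ sᵢⱼ⁺`**,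
  with the `⁻` and `|·|` forms, and on `T³` `…integral_posPart_vorticity_sub_le` —
  **`∫_{T³} ωₐ(t)⁺ − ∫_{T³} ωₐ(t₀)⁺ ≤ ∫_{t₀}ᵗ ∫_{T³} (((ω·∇)u)ₐ + (∇ × f)ₐ)⁺`**; for a force with
  vanishing `a`-curl the bound is the positive part of the stretching–tilting term alone
  (`…_of_curlFree`).
* the LOCALISED forms `…integral_posPart_torusVorticityTensor_sub_le_setIntegral` (any `d`) and
  `…integral_posPart_vorticity_sub_le_setIntegral` (`T³`; with the level-`l` variants `…_sub_sub_…`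
  and `…_of_curlFree`) —
  **`∫_{T³} ωₐ(t)⁺ − ∫_{T³} ωₐ(t₀)⁺ ≤ ∫_{t₀}ᵗ ∫_{x : ωₐ(τ, x) > 0} (((ω·∇)u)ₐ + (∇ × f)ₐ)(τ, x) dx dτ`**:
  the SIGNED source integrated over the co-signed set only (from the localised Kružkov /
  Crandall–Tartar estimate `IsClassicalScalarTransportForcedOn.integral_posPart_sub_le_setIntegral`);
* mean-zero bookkeeping for smooth fields (namespace `Literature.Analysis.FluidPDE`):
  `integral_torusVorticityTensor_eq_zero` (`∫ Wᵢⱼ = 0`, so `∫ Wᵢⱼ⁺ = ∫ Wᵢⱼ⁻`,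
  `integral_posPart_torusVorticityTensor_eq_integral_negPart`); on `T³`
  `sum_partialDeriv_torusVorticityTensor_cyclic_eq_zero` (`div ω = 0`),
  `sum_torusVorticityTensor_mul_partialDeriv_eq_sum_partialDeriv_mul` (`((ω·∇)v)ₐ = div(vₐ ω)`),
  `integral_sum_torusVorticityTensor_mul_partialDeriv_eq_zero` (`∫_{T³} ((ω·∇)v)ₐ = 0`) and
  `…integral_vorticitySource_eq_zero` (the full source of `ωₐ` has zero mean along a solution).
* `tendsto_integral_thinBand_vorticityFlux` — the co-signed-set stretching
  `∫_{ωₐ > 0} ((ω·∇)v)ₐ` is minus the limit of the fluxes of `vₐ ω` against `∇ωₐ` through the thin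
  nodal bands `{0 < ωₐ < 1/(n+1)}` (smeared Gauss–Green `Torus.tendsto_integral_thinBand_flux` of
  `PassiveScalarForcedClassicalEntropy`): co-signed flux in a fixed direction is created exactly by
  the transport of `ω` weighted by `vₐ` across the nodal surface `{ωₐ = 0}`.

Reading (census «H_ν» of the cell `ns-blowup`, (iii) theorem side — does viscous reconnection
raise the maximal single-structure co-signed flux?): `∫_{T³} (ω·e)⁺ dx` is the average over the
sections `{x·e = c}` of the co-signed flux through them. The theorems say, in every dimension and
for every classical solution: the viscous term contributes `−ν∫β″(ω·e)‖∇(ω·e)‖² ≤ 0` to every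
convex functional of every vorticity component, and transport contributes nothing; the
section-averaged co-signed flux in a fixed direction is raised ONLY by the positive part of the
inviscid stretching–tilting source `((ω·∇)u)·e` (and by co-signed forcing). In `d = 2` the source
vanishes identically (`TorusPlanarVorticityCoSignedFlux`: `∫ ω⁺` non-increasing). What viscosity
can do in `d = 3` is change the geometry on which stretching then acts (reconnection); whether
that indirect route ever beats the parents' flux is NOT addressed here — the sign of
`∫_{ω·e>0} ((ω·∇)u)·e` is free. The localised forms make exactly this set integral the bound: the
total stretching `∫_{T³} ((ω·∇)u)·e = ∫ div((u·e)ω)` vanishes identically, so co-signed flux in a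
fixed direction is created only by the distribution of the stretching across the nodal surface
`{ω·e = 0}`, i.e. by the net outflow of `(u·e)ω` from the co-signed region.

## References

* A. J. Majda, A. L. Bertozzi, *Vorticity and Incompressible Flow*, CUP (2002), §1.4 eqs.
  (1.31)–(1.33) (held text, chunks 18–19), §1.7 Prop. 1.12 and its proof (conservation of the
  total flux of vorticity (1.65): `div ω ≡ 0`, the stretching term a perfect divergence; held
  text, chunks 28–29), §2.1 (2.5)–(2.6) and §2.4.1 (2.91). [`MajdaBertozziCUP2002`]
* L. C. Evans, *Partial Differential Equations*, 2nd ed., AMS (2010), App. C.2 Thm. 1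
  (Gauss–Green; on the torus: integrals of derivatives vanish, tree
  `Torus.integral_partialDeriv_eq_zero_holds`). [`Evans2010`]
* P. Constantin, *Navier–Stokes equations and area of interfaces*, Comm. Math. Phys. 129 (1990)
  241–266, §2 (2.6)–(2.7): the companion balance for `|ω|` (tree:
  `TorusNSDirectionDissipation`). [`Constantin1990`]
* Th. Gallay, C. E. Wayne, Comm. Math. Phys. 255 (2005) = arXiv:math/0402449, Prop. 2.6 and
  Lemma 3.1. [`GallayWayne2005`]
* R. J. DiPerna, P.-L. Lions, Invent. Math. 98 (1989), §II.3. [`DiPernaLions1989Invent`]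
-/

noncomputable section

open Set MeasureTheory Finset
open scoped ContDiff InnerProductSpace RealInnerProductSpace

/-! ### Mean-zero bookkeeping for smooth fields: `∫ Wᵢⱼ = 0` on `T^d`; on `T³` `div ω = 0`,
`((ω·∇)v)_c = div(v_c ω)` and `∫_{T³} ((ω·∇)v)_c = 0` -/

namespace Literature.Analysis.FluidPDE

open Literature.Analysis.FunctionSpaces

variable {d : Type*} [Fintype d] [DecidableEq d]

/-- `Wᵢⱼ` of a smooth field is smooth (file-private copy of the helper of
`TorusVorticityTensorTransport`). [folklore] -/
private theorem isSmooth_torusVorticityTensor_aux {v : UnitAddTorus d → EuclideanSpace ℝ d}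
    (hv : Torus.IsSmooth v) (i j : d) : Torus.IsSmooth (torusVorticityTensor v i j) :=
  ((hv.partialDeriv i).apply j).sub ((hv.partialDeriv j).apply i)

/-- `∂ₖWᵢⱼ = (∂ₖ∂ᵢv)ⱼ − (∂ₖ∂ⱼv)ᵢ` for smooth `v` (file-private copy of the helper of
`TorusVorticityTensorTransport`). [folklore] -/
private theorem partialDeriv_torusVorticityTensor_aux {v : UnitAddTorus d → EuclideanSpace ℝ d}
    (hv : Torus.IsSmooth v) (i j k : d) (x : UnitAddTorus d) :
    Torus.partialDeriv k (torusVorticityTensor v i j) x =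
      Torus.partialDeriv k (Torus.partialDeriv i v) x j -
        Torus.partialDeriv k (Torus.partialDeriv j v) x i := by
  have hi : Torus.IsContDiff 1 (fun y => Torus.partialDeriv i v y j) :=
    ((hv.partialDeriv i).apply j).isContDiff (by simp)
  have hj : Torus.IsContDiff 1 (fun y => -Torus.partialDeriv j v y i) :=
    ((hv.partialDeriv j).apply i).neg.isContDiff (by simp)
  have hfun : torusVorticityTensor v i j =
      (fun y => Torus.partialDeriv i v y j) + fun y => -Torus.partialDeriv j v y i := by
    funext y; simp [torusVorticityTensor, sub_eq_add_neg]
  rw [hfun, Torus.partialDeriv_add hi hj k, Pi.add_apply, Torus.partialDeriv_neg,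
    Torus.partialDeriv_apply_coord ((hv.partialDeriv i).isContDiff (by simp)),
    Torus.partialDeriv_apply_coord ((hv.partialDeriv j).isContDiff (by simp))]
  ring

/-- **Every vorticity-tensor entry of a smooth field has zero mean on the torus**:
`∫_{T^d} Wᵢⱼ = ∫ (∂ᵢv)ⱼ − ∫ (∂ⱼv)ᵢ = 0` — the Gauss–Green theorem `∫_U u_{xᵢ} dx = ∫_{∂U} u νⁱ dS`
on the boundaryless torus (tree `Torus.integral_partialDeriv_eq_zero_holds`); the periodic case of
the "total flux of vorticity" of Majda–Bertozzi 2002, §1.7 (1.65), which on `T^d` is not only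
conserved but zero. [cite: Evans2010, App. C.2 Thm. 1] -/
theorem integral_torusVorticityTensor_eq_zero {v : UnitAddTorus d → EuclideanSpace ℝ d}
    (hv : Torus.IsSmooth v) (i j : d) : ∫ x, torusVorticityTensor v i j x = 0 := by
  have hv1 : Torus.IsContDiff 1 v := hv.isContDiff (by simp)
  have hint : ∀ m n : d, ∫ x, Torus.partialDeriv m v x n = 0 := fun m n => by
    have h0 := Torus.integral_partialDeriv_eq_zero_holds (hv.apply n) m
    simpa only [Torus.partialDeriv_apply_coord hv1] using h0
  have hi : Integrable (fun x => Torus.partialDeriv i v x j) (volume : Measure (UnitAddTorus d)) :=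
    ((hv.partialDeriv i).apply j).integrable
  have hj : Integrable (fun x => Torus.partialDeriv j v x i) (volume : Measure (UnitAddTorus d)) :=
    ((hv.partialDeriv j).apply i).integrable
  simp only [torusVorticityTensor]
  rw [integral_sub hi hj, hint i j, hint j i, sub_zero]

/-- Hence **co-signed and counter-signed masses of a vorticity-tensor entry coincide**:
`∫ Wᵢⱼ⁺ = ∫ Wᵢⱼ⁻` for every smooth `v` on `T^d` — `Wᵢⱼ = Wᵢⱼ⁺ − Wᵢⱼ⁻` has zero mean by the
Gauss–Green theorem on the boundaryless torus (`integral_torusVorticityTensor_eq_zero`); in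
particular `∫ |Wᵢⱼ| = 2 ∫ Wᵢⱼ⁺`. [cite: Evans2010, App. C.2 Thm. 1] -/
theorem integral_posPart_torusVorticityTensor_eq_integral_negPart
    {v : UnitAddTorus d → EuclideanSpace ℝ d} (hv : Torus.IsSmooth v) (i j : d) :
    ∫ x, (torusVorticityTensor v i j x)⁺ = ∫ x, (torusVorticityTensor v i j x)⁻ := by
  have hc : Continuous (torusVorticityTensor v i j) := (isSmooth_torusVorticityTensor_aux hv i j).continuous
  have ip : Integrable (fun x => (torusVorticityTensor v i j x)⁺) (volume : Measure (UnitAddTorus d)) :=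
    (continuous_posPart.comp hc).integrable_unitAddTorus
  have ine : Integrable (fun x => (torusVorticityTensor v i j x)⁻) (volume : Measure (UnitAddTorus d)) :=
    (continuous_negPart.comp hc).integrable_unitAddTorus
  have e : (∫ x, (torusVorticityTensor v i j x)⁺) - ∫ x, (torusVorticityTensor v i j x)⁻ = 0 := by
    rw [← integral_sub ip ine, ← integral_torusVorticityTensor_eq_zero hv i j]
    exact integral_congr_ae (Filter.Eventually.of_forall fun x => posPart_sub_negPart _)
  exact sub_eq_zero.1 e

/-- **`div ω = 0` on `T³`** (Majda–Bertozzi 2002, §1.7, proof of Prop. 1.12: "because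
`ω = curl v`, we have `div ω ≡ 0`"; the compatibility condition (2.91) of §2.4.1), in coordinates:
`∑ₖ ∂ₖωₖ = ∑ₖ ∂ₖW_{k+1,k+2} = 0` for every smooth `v` (symmetry of second derivatives, tree
`Torus.partialDeriv_comm`; the tree's vector-field form on `T³` is `divergence_curl` of
`OnsagerBDSVBiotSavart`). [cite: MajdaBertozziCUP2002, §1.7 proof of Prop. 1.12 and §2.4.1 eq. (2.91)] -/
theorem sum_partialDeriv_torusVorticityTensor_cyclic_eq_zero
    {v : UnitAddTorus (Fin 3) → EuclideanSpace ℝ (Fin 3)} (hv : Torus.IsSmooth v)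
    (x : UnitAddTorus (Fin 3)) :
    ∑ k, Torus.partialDeriv k (torusVorticityTensor v (k + 1) (k + 2)) x = 0 := by
  have e : ∀ k : Fin 3, Torus.partialDeriv k (torusVorticityTensor v (k + 1) (k + 2)) x =
      Torus.partialDeriv k (Torus.partialDeriv (k + 1) v) x (k + 2) -
        Torus.partialDeriv k (Torus.partialDeriv (k + 2) v) x (k + 1) :=
    fun k => partialDeriv_torusVorticityTensor_aux hv _ _ k x
  have i01 : ((0 : Fin 3) + 1) = 1 := rfl
  have i02 : ((0 : Fin 3) + 2) = 2 := rfl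
  have i11 : ((1 : Fin 3) + 1) = 2 := rfl
  have i12 : ((1 : Fin 3) + 2) = 0 := rfl
  have i21 : ((2 : Fin 3) + 1) = 0 := rfl
  have i22 : ((2 : Fin 3) + 2) = 1 := rfl
  rw [Fin.sum_univ_three, e, e, e, i01, i02, i11, i12, i21, i22,
    Torus.partialDeriv_comm hv 0 1 x, Torus.partialDeriv_comm hv 0 2 x,
    Torus.partialDeriv_comm hv 1 2 x]
  ring

/-- **`((ω·∇)v)_c = div(v_c ω)` on `T³`**: `∑ₖ ωₖ∂ₖv_c = ∑ₖ ∂ₖ(v_c ωₖ)` pointwise for every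
smooth `v` and `c ∈ Fin 3`, `ωₖ = W_{k+1,k+2}` (Leibniz and `div ω = 0`) — the stretching–tilting
of a vorticity component is "a perfect divergence", that of the vorticity flux weighted by that
velocity component (Majda–Bertozzi 2002, §1.7, proof of Prop. 1.12: `ω·∇g = ∑ⱼ [ωʲ g]_{xⱼ}`,
"in the last step we have used the condition `div ω = 0`", there with `g = x × v` for the impulse
and with `g = vⁱ` for the vorticity flux (1.65)). [cite: MajdaBertozziCUP2002, §1.7 proof of Prop. 1.12] -/
theorem sum_torusVorticityTensor_mul_partialDeriv_eq_sum_partialDeriv_mul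
    {v : UnitAddTorus (Fin 3) → EuclideanSpace ℝ (Fin 3)} (hv : Torus.IsSmooth v) (c : Fin 3)
    (x : UnitAddTorus (Fin 3)) :
    ∑ k, torusVorticityTensor v (k + 1) (k + 2) x * Torus.partialDeriv k v x c =
      ∑ k, Torus.partialDeriv k (fun y => v y c * torusVorticityTensor v (k + 1) (k + 2) y) x := by
  have hv1 : Torus.IsContDiff 1 v := hv.isContDiff (by simp)
  have hvc : Torus.IsContDiff 1 (fun y => v y c) := (hv.apply c).isContDiff (by simp)
  have hW : ∀ i j, Torus.IsContDiff 1 (torusVorticityTensor v i j) := fun i j =>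
    (isSmooth_torusVorticityTensor_aux hv i j).isContDiff (by simp)
  have e : ∀ k, Torus.partialDeriv k (fun y => v y c * torusVorticityTensor v (k + 1) (k + 2) y) x =
      v x c * Torus.partialDeriv k (torusVorticityTensor v (k + 1) (k + 2)) x +
        Torus.partialDeriv k (fun y => v y c) x * torusVorticityTensor v (k + 1) (k + 2) x :=
    fun k => Torus.partialDeriv_mul hvc (hW _ _) k x
  simp only [e, Finset.sum_add_distrib, ← Finset.mul_sum,
    sum_partialDeriv_torusVorticityTensor_cyclic_eq_zero hv x, mul_zero, zero_add,
    Torus.partialDeriv_apply_coord hv1]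
  exact Finset.sum_congr rfl fun k _ => mul_comm _ _

/-- **The stretching–tilting of every vorticity component has zero mean on `T³`**:
`∫_{T³} ∑ₖ ωₖ∂ₖv_c = ∫_{T³} div(v_c ω) = 0` for every smooth `v` (no divergence-free hypothesis
on `v` needed) — the computation behind the conservation of the total flux of vorticity
`∫ ω dx` (Majda–Bertozzi 2002, §1.7 Prop. 1.12 (i), eq. (1.65): the stretching term is a perfect
divergence and integrates to zero by Green's formula), in the periodic setting. Only the
distribution of the stretching relative to the nodal set `{ω_c = 0}` — not its total — can move
the co-signed mass `∫ ω_c⁺`. [cite: MajdaBertozziCUP2002, §1.7 Prop. 1.12 eq. (1.65)] -/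
theorem integral_sum_torusVorticityTensor_mul_partialDeriv_eq_zero
    {v : UnitAddTorus (Fin 3) → EuclideanSpace ℝ (Fin 3)} (hv : Torus.IsSmooth v) (c : Fin 3) :
    ∫ x, ∑ k, torusVorticityTensor v (k + 1) (k + 2) x * Torus.partialDeriv k v x c = 0 := by
  simp_rw [sum_torusVorticityTensor_mul_partialDeriv_eq_sum_partialDeriv_mul hv c]
  have hs : ∀ k : Fin 3,
      Torus.IsSmooth (fun y => v y c * torusVorticityTensor v (k + 1) (k + 2) y) :=
    fun k => ContDiff.mul (hv.apply c) (isSmooth_torusVorticityTensor_aux hv _ _)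
  rw [integral_finsetSum _ fun k _ => ((hs k).partialDeriv k).integrable]
  exact Finset.sum_eq_zero fun k _ => Torus.integral_partialDeriv_eq_zero_holds (hs k) k

/-- **The co-signed-set stretching of a vorticity component is a thin-nodal-band flux.** For every
smooth `v` on `T³`, `c ∈ Fin 3`, `ωₖ = W_{k+1,k+2}` and the approximate indicators
`gₙ(r) = smoothTransition((n+1) r)` (`gₙ' ≥ 0` supported in `0 ≤ r ≤ 1/(n+1)`, `∫ gₙ' = 1`):
`∫ gₙ'(ω_c) ∑ₖ ∂ₖω_c (v_c ωₖ) → −∫_{x : ω_c(x) > 0} ∑ₖ ωₖ∂ₖv_c` as `n → ∞` — the integral over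
the co-signed set `{ω_c > 0}` of the stretching–tilting `((ω·∇)v)_c = div(v_c ω)` (the quantity
that bounds the growth of `∫ ω_c⁺` in
`IsClassicalNSSolutionOn.integral_posPart_vorticity_sub_le_setIntegral`) is minus the limit of
the fluxes of the field `v_c ω` against `∇ω_c` (`∑ₖ ∂ₖω_c ωₖ = (ω·∇)ω_c`, weighted by `v_c`)
through the thin nodal bands `{0 < ω_c < 1/(n+1)}`: the Green's-formula step of Majda–Bertozzi
2002, §1.7 (proof of Prop. 1.12: the stretching term is a perfect divergence) carried out on the
super-level set `{ω_c > 0}` instead of the whole space, via the smeared Gauss–Green theorem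
`Torus.tendsto_integral_thinBand_flux` (Evans, App. C.2 Thm. 1, no regularity of `{ω_c = 0}`
needed). [cite: MajdaBertozziCUP2002, §1.7 proof of Prop. 1.12; Evans2010, App. C.2 Thm. 1] -/
theorem tendsto_integral_thinBand_vorticityFlux
    {v : UnitAddTorus (Fin 3) → EuclideanSpace ℝ (Fin 3)} (hv : Torus.IsSmooth v) (c : Fin 3) :
    Filter.Tendsto (fun n : ℕ => ∫ x, deriv (fun r => Real.smoothTransition (((n : ℝ) + 1) * r))
          (torusVorticityTensor v (c + 1) (c + 2) x) *
        ∑ k, Torus.partialDeriv k (torusVorticityTensor v (c + 1) (c + 2)) x *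
          (v x c * torusVorticityTensor v (k + 1) (k + 2) x)) Filter.atTop
      (nhds (-(∫ x in {x | 0 < torusVorticityTensor v (c + 1) (c + 2) x},
        ∑ k, torusVorticityTensor v (k + 1) (k + 2) x * Torus.partialDeriv k v x c))) := by
  have hW : ∀ i j, Torus.IsSmooth (torusVorticityTensor v i j) := fun i j =>
    isSmooth_torusVorticityTensor_aux hv i j
  have hF : ∀ k : Fin 3,
      Torus.IsSmooth (fun x => v x c * torusVorticityTensor v (k + 1) (k + 2) x) :=
    fun k => ContDiff.mul (hv.apply c) (hW _ _)
  have hlim := Torus.tendsto_integral_thinBand_flux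
    (F := fun k x => v x c * torusVorticityTensor v (k + 1) (k + 2) x) (hW (c + 1) (c + 2)) hF
  have e : (∫ x in {x | 0 < torusVorticityTensor v (c + 1) (c + 2) x},
        ∑ k, Torus.partialDeriv k (fun y => v y c * torusVorticityTensor v (k + 1) (k + 2) y) x) =
      ∫ x in {x | 0 < torusVorticityTensor v (c + 1) (c + 2) x},
        ∑ k, torusVorticityTensor v (k + 1) (k + 2) x * Torus.partialDeriv k v x c :=
    integral_congr_ae (Filter.Eventually.of_forall fun x =>
      (sum_torusVorticityTensor_mul_partialDeriv_eq_sum_partialDeriv_mul hv c x).symm)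
  rw [e] at hlim
  exact hlim

end Literature.Analysis.FluidPDE

namespace Literature.Analysis.FunctionSpaces.Torus.IsClassicalNSSolutionOn

open Literature.Analysis.FluidPDE Literature.Analysis.FunctionSpaces

variable {d : Type*} [Fintype d] [DecidableEq d]
variable {a b ν : ℝ} {f u : ℝ → UnitAddTorus d → EuclideanSpace ℝ d} {p : ℝ → UnitAddTorus d → ℝ}

/-! ### Smoothness bookkeeping -/

/-- The force of a classical solution is jointly smooth on a time set of unique differentiability:
`f = ∂ₜu + (u·∇)u − νΔu + ∇p` by the momentum equation (file-private copy of the tree's helper in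
`TorusClassicalLerayHopfProofs`). [folklore] -/
private theorem isSmoothSpaceTimeOn_force' {S : Set ℝ} (h : Torus.IsClassicalNSSolutionOn S ν f u p)
    (hU : UniqueDiffOn ℝ S) : Torus.IsSmoothSpaceTimeOn S f := by
  have hu := h.smooth_velocity
  have hG : Torus.IsSmoothSpaceTimeOn S (fun t x => Torus.timeDerivWithin S u t x +
      Torus.convect (u t) (u t) x - ν • Torus.laplacian (u t) x + Torus.gradient (p t) x) :=
    (((hu.timeDerivWithin hU).add (hu.convect hu hU)).sub ((hu.laplacian hU).const_smul ν)).add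
      (h.smooth_pressure.gradient hU)
  refine ContDiffOn.congr hG fun z hz => ?_
  obtain ⟨t, y⟩ := z
  have ht : t ∈ S := (mem_prod.1 hz).1
  simp only [Torus.stLift_apply]
  rw [h.momentum t ht (Torus.proj y)]
  abel

omit [DecidableEq d] in
/-- Finite sums of jointly smooth scalar fields are jointly smooth. [folklore] -/
private theorem isSmoothSpaceTimeOn_fsum {S : Set ℝ} {g : d → ℝ → UnitAddTorus d → ℝ}
    (hg : ∀ k, Torus.IsSmoothSpaceTimeOn S (g k)) :
    Torus.IsSmoothSpaceTimeOn S (fun t x => ∑ k, g k t x) := by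
  have := Torus.IsSmoothSpaceTimeOn.sum (s := Finset.univ) fun k (_ : k ∈ Finset.univ) => hg k
  refine ContDiffOn.congr this fun z _ => ?_
  obtain ⟨t, y⟩ := z
  simp only [Torus.stLift_apply]

/-- The stretching–tilting source `−(∑ₖ ∂ᵢuₖ∂ₖuⱼ − ∑ₖ ∂ⱼuₖ∂ₖuᵢ) + (∂ᵢfⱼ − ∂ⱼfᵢ)` of `Wᵢⱼ` is
jointly smooth along a classical solution on `[a, b]`, `a < b`. [folklore] -/
private theorem isSmoothSpaceTimeOn_tensorSource (h : Torus.IsClassicalNSSolutionOn (Icc a b) ν f u p)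
    (hab : a < b) (i j : d) :
    Torus.IsSmoothSpaceTimeOn (Icc a b) (fun t x =>
      (Torus.partialDeriv i (f t) x j - Torus.partialDeriv j (f t) x i) -
        ((∑ k, Torus.partialDeriv i (u t) x k * Torus.partialDeriv k (u t) x j) -
          ∑ k, Torus.partialDeriv j (u t) x k * Torus.partialDeriv k (u t) x i)) := by
  have hU : UniqueDiffOn ℝ (Icc a b) := uniqueDiffOn_Icc hab
  have hf := isSmoothSpaceTimeOn_force' h hU
  have hD : ∀ m n, Torus.IsSmoothSpaceTimeOn (Icc a b) (fun t x => Torus.partialDeriv m (u t) x n) :=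
    fun m n => (h.smooth_velocity.partialDeriv hU m).apply n
  have hF : ∀ m n, Torus.IsSmoothSpaceTimeOn (Icc a b) (fun t x => Torus.partialDeriv m (f t) x n) :=
    fun m n => (hf.partialDeriv hU m).apply n
  exact ((hF i j).sub (hF j i)).sub
    ((isSmoothSpaceTimeOn_fsum fun k => (hD i k).mul (hD k j)).sub
      (isSmoothSpaceTimeOn_fsum fun k => (hD j k).mul (hD k i)))

/-! ### Every vorticity-tensor entry is a forced passive scalar of its own velocity -/

/-- **Majda–Bertozzi 2002, (1.31), on the torus, as a forced scalar equation.** Along a classical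
solution of forced Navier–Stokes on `T^d × [a, b]` (`a < b`), each vorticity-tensor entry
`Wᵢⱼ(t, x) = (∂ᵢu)ⱼ − (∂ⱼu)ᵢ` is a classical solution of the forced passive-scalar equation
`∂ₜWᵢⱼ + ⟪u, ∇Wᵢⱼ⟫ = νΔWᵢⱼ + sᵢⱼ` with the divergence-free drift `u` and the source
`sᵢⱼ = (∂ᵢfⱼ − ∂ⱼfᵢ) − (∑ₖ ∂ᵢuₖ∂ₖuⱼ − ∑ₖ ∂ⱼuₖ∂ₖuᵢ)` (curl of the force minus the antisymmetric
part of `∇u∇u` — the `Ω𝒟 + 𝒟Ω` term of (1.31)): the `(i, j)` entry of the tree's transport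
identity `timeDerivWithin_torusVorticityTensor`, with `∑ₖ uₖ∂ₖWᵢⱼ = ⟪u, ∇Wᵢⱼ⟫`. [cite: MajdaBertozziCUP2002, §1.4 eq. (1.31)] -/
theorem isClassicalScalarTransportForcedOn_torusVorticityTensor
    (h : Torus.IsClassicalNSSolutionOn (Icc a b) ν f u p) (hab : a < b) (i j : d) :
    Torus.IsClassicalScalarTransportForcedOn (Icc a b) ν u
      (fun t x => (Torus.partialDeriv i (f t) x j - Torus.partialDeriv j (f t) x i) -
        ((∑ k, Torus.partialDeriv i (u t) x k * Torus.partialDeriv k (u t) x j) -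
          ∑ k, Torus.partialDeriv j (u t) x k * Torus.partialDeriv k (u t) x i))
      (fun t x => torusVorticityTensor (u t) i j x) := by
  have hU : UniqueDiffOn ℝ (Icc a b) := uniqueDiffOn_Icc hab
  have hWst : Torus.IsSmoothSpaceTimeOn (Icc a b) (fun t x => torusVorticityTensor (u t) i j x) :=
    ((h.smooth_velocity.partialDeriv hU i).apply j).sub ((h.smooth_velocity.partialDeriv hU j).apply i)
  refine ⟨h.smooth_velocity, isSmoothSpaceTimeOn_tensorSource h hab i j, hWst, fun t ht x => ?_,
    h.divFree⟩
  have key := h.timeDerivWithin_torusVorticityTensor hab ht i j x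
  have hW : Torus.IsSmooth (fun x => torusVorticityTensor (u t) i j x) := hWst.isSmooth_slice ht
  have hconv := Torus.inner_gradient_eq_sum_mul_partialDeriv (hW.isContDiff (by decide)) (u t x) x
  have eW : (fun x => torusVorticityTensor (u t) i j x) = torusVorticityTensor (u t) i j := rfl
  rw [hconv, eW, key]
  ring

/-- **The renormalised balance of a vorticity component.** For a classical solution on
`T^d × [a, b]` (`a < b`), a smooth `β : ℝ → ℝ` and `t ∈ [a, b]`:
`d/dt ∫ β(Wᵢⱼ) = −ν ∫ β″(Wᵢⱼ)‖∇Wᵢⱼ‖² + ∫ β′(Wᵢⱼ) sᵢⱼ`, `sᵢⱼ` the stretching–tilting-plus-force-curl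
source of `isClassicalScalarTransportForcedOn_torusVorticityTensor` — the viscous term enters every
convex functional of every vorticity component with a sign (`≤ 0` for `β″ ≥ 0`, `ν ≥ 0`), the
transport term not at all (Majda–Bertozzi 2002, (1.31)–(1.32) paired with `β′(Wᵢⱼ)`; the `|ω|`
analogue is Constantin 1990, (2.7), tree `TorusNSDirectionDissipation`). [cite: MajdaBertozziCUP2002, §1.4 eqs. (1.31)–(1.32)] -/
theorem hasDerivWithinAt_integral_comp_torusVorticityTensor
    (h : Torus.IsClassicalNSSolutionOn (Icc a b) ν f u p) (hab : a < b) (i j : d) {β : ℝ → ℝ}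
    (hβ : ContDiff ℝ ∞ β) {t : ℝ} (ht : t ∈ Icc a b) :
    HasDerivWithinAt (fun τ => ∫ x, β (torusVorticityTensor (u τ) i j x))
      (-ν * (∫ x, deriv (deriv β) (torusVorticityTensor (u t) i j x) *
          ‖Torus.gradient (torusVorticityTensor (u t) i j) x‖ ^ 2) +
        ∫ x, deriv β (torusVorticityTensor (u t) i j x) *
          ((Torus.partialDeriv i (f t) x j - Torus.partialDeriv j (f t) x i) -
            ((∑ k, Torus.partialDeriv i (u t) x k * Torus.partialDeriv k (u t) x j) -
              ∑ k, Torus.partialDeriv j (u t) x k * Torus.partialDeriv k (u t) x i)))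
      (Icc a b) t :=
  (h.isClassicalScalarTransportForcedOn_torusVorticityTensor hab i j).hasDerivWithinAt_integral_comp
    (convex_Icc a b) hβ ht

/-- **The co-signed mass of a vorticity component is raised only by the positive part of its
stretching–tilting (+ force-curl) source.** For a classical solution on `T^d × [a, b]` with
`ν ≥ 0` and `t ∈ [a, b]`:
`∫ Wᵢⱼ(t)⁺ − ∫ Wᵢⱼ(a)⁺ ≤ ∫ₐᵗ ∫ ((∂ᵢfⱼ − ∂ⱼfᵢ) − (∑ₖ ∂ᵢuₖ∂ₖuⱼ − ∑ₖ ∂ⱼuₖ∂ₖuᵢ))⁺` —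
viscosity and incompressible transport contribute nothing positive (Gallay–Wayne 2005, Lemma 3.1,
for the unforced planar case, where the right-hand side is absent; here its sourced form
`IsClassicalScalarTransportForcedOn.integral_posPart_sub_le` applied to MB (1.31)). [cite: GallayWayne2005, Lemma 3.1] -/
theorem integral_posPart_torusVorticityTensor_sub_le
    (h : Torus.IsClassicalNSSolutionOn (Icc a b) ν f u p) (hab : a < b) (hν : 0 ≤ ν) (i j : d)
    {t : ℝ} (ht : t ∈ Icc a b) :
    (∫ x, (torusVorticityTensor (u t) i j x)⁺) - (∫ x, (torusVorticityTensor (u a) i j x)⁺) ≤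
      ∫ τ in a..t, ∫ x, ((Torus.partialDeriv i (f τ) x j - Torus.partialDeriv j (f τ) x i) -
        ((∑ k, Torus.partialDeriv i (u τ) x k * Torus.partialDeriv k (u τ) x j) -
          ∑ k, Torus.partialDeriv j (u τ) x k * Torus.partialDeriv k (u τ) x i))⁺ :=
  (h.isClassicalScalarTransportForcedOn_torusVorticityTensor hab i j).integral_posPart_sub_le hν
    Subset.rfl ht

/-- The counter-signed mass: `∫ Wᵢⱼ(t)⁻ − ∫ Wᵢⱼ(a)⁻ ≤ ∫ₐᵗ ∫ sᵢⱼ⁻` (`ν ≥ 0`). [cite: GallayWayne2005, Lemma 3.1] -/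
theorem integral_negPart_torusVorticityTensor_sub_le
    (h : Torus.IsClassicalNSSolutionOn (Icc a b) ν f u p) (hab : a < b) (hν : 0 ≤ ν) (i j : d)
    {t : ℝ} (ht : t ∈ Icc a b) :
    (∫ x, (torusVorticityTensor (u t) i j x)⁻) - (∫ x, (torusVorticityTensor (u a) i j x)⁻) ≤
      ∫ τ in a..t, ∫ x, ((Torus.partialDeriv i (f τ) x j - Torus.partialDeriv j (f τ) x i) -
        ((∑ k, Torus.partialDeriv i (u τ) x k * Torus.partialDeriv k (u τ) x j) -
          ∑ k, Torus.partialDeriv j (u τ) x k * Torus.partialDeriv k (u τ) x i))⁻ :=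
  (h.isClassicalScalarTransportForcedOn_torusVorticityTensor hab i j).integral_negPart_sub_le hν
    Subset.rfl ht

/-- The `L¹` mass: `∫ |Wᵢⱼ(t)| − ∫ |Wᵢⱼ(a)| ≤ ∫ₐᵗ ∫ |sᵢⱼ|` (`ν ≥ 0`; the unforced planar case is
Gallay–Wayne 2005, Lemma 3.1, "the `L¹` norm is nonincreasing"). [cite: GallayWayne2005, Lemma 3.1] -/
theorem integral_abs_torusVorticityTensor_sub_le
    (h : Torus.IsClassicalNSSolutionOn (Icc a b) ν f u p) (hab : a < b) (hν : 0 ≤ ν) (i j : d)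
    {t : ℝ} (ht : t ∈ Icc a b) :
    (∫ x, |torusVorticityTensor (u t) i j x|) - (∫ x, |torusVorticityTensor (u a) i j x|) ≤
      ∫ τ in a..t, ∫ x, |(Torus.partialDeriv i (f τ) x j - Torus.partialDeriv j (f τ) x i) -
        ((∑ k, Torus.partialDeriv i (u τ) x k * Torus.partialDeriv k (u τ) x j) -
          ∑ k, Torus.partialDeriv j (u τ) x k * Torus.partialDeriv k (u τ) x i)| :=
  (h.isClassicalScalarTransportForcedOn_torusVorticityTensor hab i j).integral_abs_sub_le hν
    Subset.rfl ht

/-- **Localised form: above every level, the co-signed mass of a vorticity-tensor entry is raised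
only by the SIGNED source acting on the super-level set.** For a classical solution on
`T^d × [a, b]` with `ν ≥ 0`, indices `i, j`, a level `l` and `t ∈ [a, b]`:
`∫ (Wᵢⱼ(t) − l)⁺ − ∫ (Wᵢⱼ(a) − l)⁺ ≤ ∫ₐᵗ ∫_{x : Wᵢⱼ(τ, x) > l} sᵢⱼ(τ, x) dx dτ`, `sᵢⱼ` the
stretching–tilting-plus-force-curl source of `isClassicalScalarTransportForcedOn_torusVorticityTensor`
— counted WITH ITS SIGN and only where `Wᵢⱼ` already exceeds the level (sharpening
`integral_posPart_torusVorticityTensor_sub_le`, whose bound is `∫ₐᵗ ∫ sᵢⱼ⁺` over all of `T^d`):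
the localised Kružkov / Crandall–Tartar order estimate
`IsClassicalScalarTransportForcedOn.integral_posPart_sub_sub_le_setIntegral` applied to MB (1.31)
(Gallay–Wayne 2005, Lemma 3.1, is the source-free planar case). [cite: GallayWayne2005, Lemma 3.1] -/
theorem integral_posPart_torusVorticityTensor_sub_sub_le_setIntegral
    (h : Torus.IsClassicalNSSolutionOn (Icc a b) ν f u p) (hab : a < b) (hν : 0 ≤ ν) (i j : d)
    (l : ℝ) {t : ℝ} (ht : t ∈ Icc a b) :
    (∫ x, (torusVorticityTensor (u t) i j x - l)⁺) - (∫ x, (torusVorticityTensor (u a) i j x - l)⁺) ≤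
      ∫ τ in a..t, ∫ x in {x | l < torusVorticityTensor (u τ) i j x},
        ((Torus.partialDeriv i (f τ) x j - Torus.partialDeriv j (f τ) x i) -
          ((∑ k, Torus.partialDeriv i (u τ) x k * Torus.partialDeriv k (u τ) x j) -
            ∑ k, Torus.partialDeriv j (u τ) x k * Torus.partialDeriv k (u τ) x i)) :=
  (h.isClassicalScalarTransportForcedOn_torusVorticityTensor hab i j).integral_posPart_sub_sub_le_setIntegral
    hν l Subset.rfl ht

/-- The case `l = 0`: `∫ Wᵢⱼ(t)⁺ − ∫ Wᵢⱼ(a)⁺ ≤ ∫ₐᵗ ∫_{x : Wᵢⱼ(τ, x) > 0} sᵢⱼ(τ, x) dx dτ` for `ν ≥ 0`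
— the signed source over the co-signed set only; transport and viscosity contribute nothing
positive. [cite: GallayWayne2005, Lemma 3.1] -/
theorem integral_posPart_torusVorticityTensor_sub_le_setIntegral
    (h : Torus.IsClassicalNSSolutionOn (Icc a b) ν f u p) (hab : a < b) (hν : 0 ≤ ν) (i j : d)
    {t : ℝ} (ht : t ∈ Icc a b) :
    (∫ x, (torusVorticityTensor (u t) i j x)⁺) - (∫ x, (torusVorticityTensor (u a) i j x)⁺) ≤
      ∫ τ in a..t, ∫ x in {x | 0 < torusVorticityTensor (u τ) i j x},
        ((Torus.partialDeriv i (f τ) x j - Torus.partialDeriv j (f τ) x i) -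
          ((∑ k, Torus.partialDeriv i (u τ) x k * Torus.partialDeriv k (u τ) x j) -
            ∑ k, Torus.partialDeriv j (u τ) x k * Torus.partialDeriv k (u τ) x i)) :=
  (h.isClassicalScalarTransportForcedOn_torusVorticityTensor hab i j).integral_posPart_sub_le_setIntegral
    hν Subset.rfl ht

/-- For a Navier–Stokes solution on `T^d × [a, b]` every vorticity-tensor entry has zero mean at
every time, hence equal co-signed and counter-signed masses: `∫ Wᵢⱼ(t)⁺ = ∫ Wᵢⱼ(t)⁻`
(`integral_posPart_torusVorticityTensor_eq_integral_negPart` for the smooth slice `u t`: Gauss–Green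
on the boundaryless torus) — the `⁺` and `⁻` ledgers of this file
(`integral_posPart_torusVorticityTensor_sub_le`, `integral_negPart_torusVorticityTensor_sub_le`)
bound one and the same quantity. [cite: Evans2010, App. C.2 Thm. 1] -/
theorem integral_posPart_torusVorticityTensor_eq_integral_negPart_of_solution
    (h : Torus.IsClassicalNSSolutionOn (Icc a b) ν f u p) (i j : d) {t : ℝ} (ht : t ∈ Icc a b) :
    ∫ x, (torusVorticityTensor (u t) i j x)⁺ = ∫ x, (torusVorticityTensor (u t) i j x)⁻ :=
  integral_posPart_torusVorticityTensor_eq_integral_negPart (h.smooth_velocity.isSmooth_slice ht) i j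

end Literature.Analysis.FunctionSpaces.Torus.IsClassicalNSSolutionOn

/-! ### `T³`: the vorticity vector `ω = (W₁₂, W₂₀, W₀₁)` and the source `(ω·∇)u + ∇ × f` -/

namespace Literature.Analysis.FunctionSpaces.Torus.IsClassicalNSSolutionOn

open Literature.Analysis.FluidPDE Literature.Analysis.FunctionSpaces

variable {a b ν : ℝ} {f u : ℝ → UnitAddTorus (Fin 3) → EuclideanSpace ℝ (Fin 3)}
  {p : ℝ → UnitAddTorus (Fin 3) → ℝ}

/-- Polynomial identity: for a `3 × 3` array `P` (`Pᵢₖ = ∂ᵢuₖ`) with `tr P = 0` and every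
`c ∈ Fin 3`, `−(∑ₖ P_{c+1,k}P_{k,c+2} − ∑ₖ P_{c+2,k}P_{k,c+1}) = ∑ₖ w_k P_{k,c}` with
`w_k = P_{k+1,k+2} − P_{k+2,k+1}` — the `c`-component of `−(Ω𝒟 + 𝒟Ω) ↦ (ω·∇)u` for
divergence-free fields. [folklore] -/
private theorem stretch_identity_fin_three (P : Fin 3 → Fin 3 → ℝ) (htr : P 0 0 + P 1 1 + P 2 2 = 0)
    (c : Fin 3) :
    -((∑ k, P (c + 1) k * P k (c + 2)) - ∑ k, P (c + 2) k * P k (c + 1)) =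
      ∑ k, (P (k + 1) (k + 2) - P (k + 2) (k + 1)) * P k c := by
  fin_cases c
  · simp [Fin.sum_univ_three]
    linear_combination (-(P 1 2 - P 2 1)) * htr
  · simp [Fin.sum_univ_three]
    linear_combination (-(P 2 0 - P 0 2)) * htr
  · simp [Fin.sum_univ_three]
    linear_combination (-(P 0 1 - P 1 0)) * htr

/-- Divergence-freeness at a point in coordinates on `T³`: `∂₀u₀ + ∂₁u₁ + ∂₂u₂ = 0`. [folklore] -/
private theorem trace_eq_zero (h : Torus.IsClassicalNSSolutionOn (Icc a b) ν f u p) {t : ℝ}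
    (ht : t ∈ Icc a b) (x : UnitAddTorus (Fin 3)) :
    Torus.partialDeriv 0 (u t) x 0 + Torus.partialDeriv 1 (u t) x 1 + Torus.partialDeriv 2 (u t) x 2 = 0 := by
  have hut : Torus.IsSmooth (u t) := h.smooth_velocity.isSmooth_slice ht
  have hu1 : Torus.IsContDiff 1 (u t) := hut.isContDiff (by decide)
  have h0 := h.divFree t ht x
  rw [Torus.divergence_eq_sum_partialDeriv_apply hu1, Fin.sum_univ_three] at h0
  exact h0

/-- **Majda–Bertozzi 2002, (1.32)–(1.33), componentwise on `T³`: each vorticity component is a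
forced passive scalar of its own velocity with source `((ω·∇)u)_c + (∇ × f)_c`.** Along a classical
solution of forced Navier–Stokes on `T³ × [a, b]` (`a < b`), for every `c ∈ Fin 3` the component
`ω_c = W_{c+1,c+2} = (∂_{c+1}u)_{c+2} − (∂_{c+2}u)_{c+1}` of `ω = ∇ × u` is a classical solution of
`∂ₜω_c + ⟪u, ∇ω_c⟫ = νΔω_c + s_c`, `s_c = ∑ₖ ωₖ ∂ₖu_c + (∂_{c+1}f_{c+2} − ∂_{c+2}f_{c+1})` (the
stretching–tilting term `((ω·∇)u)_c` plus the `c`-component of the curl of the force): the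
tensor form `isClassicalScalarTransportForcedOn_torusVorticityTensor` with the pointwise identity
`−(Ω𝒟 + 𝒟Ω) ↦ (ω·∇)u` for divergence-free fields ("`Ωh = ½ω × h`", MB (1.21); the
"straightforward calculation" from (1.31) to (1.32)). [cite: MajdaBertozziCUP2002, §1.4 eqs. (1.32)–(1.33)] -/
theorem isClassicalScalarTransportForcedOn_vorticity
    (h : Torus.IsClassicalNSSolutionOn (Icc a b) ν f u p) (hab : a < b) (c : Fin 3) :
    Torus.IsClassicalScalarTransportForcedOn (Icc a b) ν u
      (fun t x => (∑ k, torusVorticityTensor (u t) (k + 1) (k + 2) x * Torus.partialDeriv k (u t) x c) +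
        (Torus.partialDeriv (c + 1) (f t) x (c + 2) - Torus.partialDeriv (c + 2) (f t) x (c + 1)))
      (fun t x => torusVorticityTensor (u t) (c + 1) (c + 2) x) := by
  have hU : UniqueDiffOn ℝ (Icc a b) := uniqueDiffOn_Icc hab
  have h0 := h.isClassicalScalarTransportForcedOn_torusVorticityTensor hab (c + 1) (c + 2)
  refine h0.congr_source ?_ fun t ht x => ?_
  · have hf := isSmoothSpaceTimeOn_force' h hU
    have hD : ∀ m n, Torus.IsSmoothSpaceTimeOn (Icc a b) (fun t x => Torus.partialDeriv m (u t) x n) :=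
      fun m n => (h.smooth_velocity.partialDeriv hU m).apply n
    have hF : ∀ m n, Torus.IsSmoothSpaceTimeOn (Icc a b) (fun t x => Torus.partialDeriv m (f t) x n) :=
      fun m n => (hf.partialDeriv hU m).apply n
    have hW : ∀ k : Fin 3, Torus.IsSmoothSpaceTimeOn (Icc a b)
        (fun t x => torusVorticityTensor (u t) (k + 1) (k + 2) x) :=
      fun k => (hD (k + 1) (k + 2)).sub (hD (k + 2) (k + 1))
    exact (isSmoothSpaceTimeOn_fsum fun k => (hW k).mul (hD k c)).add ((hF _ _).sub (hF _ _))
  · have key := stretch_identity_fin_three (fun i k => Torus.partialDeriv i (u t) x k)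
      (trace_eq_zero h ht x) c
    simp only [torusVorticityTensor] at key ⊢
    linarith [key]

/-- **On `T³` the co-signed flux of a vorticity component is raised only by stretching–tilting and
co-signed forcing, never by viscosity.** For a classical solution of forced Navier–Stokes on
`T³ × [a, b]` with `ν ≥ 0`, every `c ∈ Fin 3` and `t ∈ [a, b]`:
`∫_{T³} ω_c(t)⁺ − ∫_{T³} ω_c(a)⁺ ≤ ∫ₐᵗ ∫_{T³} (∑ₖ ωₖ∂ₖu_c + (∇ × f)_c)⁺`
(`∫_{T³} ω_c⁺ dx` is the average over the sections `{x_c = const}` of the co-signed flux through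
them). The vorticity equation (1.33) of Majda–Bertozzi 2002 read as a forced passive-scalar
equation for `ω_c`, combined with the co-signed-mass estimate of Gallay–Wayne 2005, Lemma 3.1 (there
source-free and planar: `∫ ω⁺` non-increasing — tree `antitoneOn_integral_posPart_planarVorticity`;
here the stretching source is carried on the right-hand side). The sign of the right-hand side is
NOT controlled: nothing is claimed about whether stretching raises the flux. [cite: GallayWayne2005, Lemma 3.1] -/
theorem integral_posPart_vorticity_sub_le
    (h : Torus.IsClassicalNSSolutionOn (Icc a b) ν f u p) (hab : a < b) (hν : 0 ≤ ν) (c : Fin 3)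
    {t : ℝ} (ht : t ∈ Icc a b) :
    (∫ x, (torusVorticityTensor (u t) (c + 1) (c + 2) x)⁺) -
        (∫ x, (torusVorticityTensor (u a) (c + 1) (c + 2) x)⁺) ≤
      ∫ τ in a..t, ∫ x, ((∑ k, torusVorticityTensor (u τ) (k + 1) (k + 2) x * Torus.partialDeriv k (u τ) x c) +
        (Torus.partialDeriv (c + 1) (f τ) x (c + 2) - Torus.partialDeriv (c + 2) (f τ) x (c + 1)))⁺ :=
  (h.isClassicalScalarTransportForcedOn_vorticity hab c).integral_posPart_sub_le hν Subset.rfl ht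

/-- The same for a force whose curl has vanishing `c`-component on `[a, b] × T³` (e.g. `f = 0` or a
gradient): `∫ ω_c(t)⁺ − ∫ ω_c(a)⁺ ≤ ∫ₐᵗ ∫ (∑ₖ ωₖ∂ₖu_c)⁺` — the positive part of the
stretching–tilting term `((ω·∇)u)_c` alone. [cite: GallayWayne2005, Lemma 3.1] -/
theorem integral_posPart_vorticity_sub_le_of_curlFree
    (h : Torus.IsClassicalNSSolutionOn (Icc a b) ν f u p) (hab : a < b) (hν : 0 ≤ ν) (c : Fin 3)
    (hf : ∀ τ ∈ Icc a b, ∀ x, Torus.partialDeriv (c + 1) (f τ) x (c + 2) = Torus.partialDeriv (c + 2) (f τ) x (c + 1))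
    {t : ℝ} (ht : t ∈ Icc a b) :
    (∫ x, (torusVorticityTensor (u t) (c + 1) (c + 2) x)⁺) -
        (∫ x, (torusVorticityTensor (u a) (c + 1) (c + 2) x)⁺) ≤
      ∫ τ in a..t, ∫ x, (∑ k, torusVorticityTensor (u τ) (k + 1) (k + 2) x * Torus.partialDeriv k (u τ) x c)⁺ := by
  have hmain := h.integral_posPart_vorticity_sub_le hab hν c ht
  have hta : Icc a t ⊆ Icc a b := Icc_subset_Icc le_rfl ht.2
  have e : ∫ τ in a..t, ∫ x, ((∑ k, torusVorticityTensor (u τ) (k + 1) (k + 2) x * Torus.partialDeriv k (u τ) x c) +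
        (Torus.partialDeriv (c + 1) (f τ) x (c + 2) - Torus.partialDeriv (c + 2) (f τ) x (c + 1)))⁺ =
      ∫ τ in a..t, ∫ x, (∑ k, torusVorticityTensor (u τ) (k + 1) (k + 2) x * Torus.partialDeriv k (u τ) x c)⁺ := by
    refine intervalIntegral.integral_congr fun τ hτ => ?_
    rw [uIcc_of_le ht.1] at hτ
    refine integral_congr_ae (Filter.Eventually.of_forall fun x => ?_)
    dsimp only
    rw [hf τ (hta hτ) x, sub_self, add_zero]
  rw [e] at hmain
  exact hmain

/-- **Renormalised balance of a vorticity component on `T³`.** For a classical solution on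
`T³ × [a, b]` (`a < b`), a smooth `β : ℝ → ℝ`, `c ∈ Fin 3` and `t ∈ [a, b]`:
`d/dt ∫ β(ω_c) = −ν ∫ β″(ω_c)‖∇ω_c‖² + ∫ β′(ω_c)(∑ₖ ωₖ∂ₖu_c + (∇ × f)_c)` — viscosity enters
every smooth functional of every vorticity component through `−ν∫β″(ω_c)‖∇ω_c‖²` (`≤ 0` for
convex `β`, `ν ≥ 0`), transport not at all, stretching–tilting and forcing through the pairing
with `β′(ω_c)` (MB (1.33) paired with `β′(ω_c)` and integrated over `T³`; the `|ω|`-weighted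
companion is Constantin 1990 (2.7) / tree `TorusNSDirectionDissipation`). [cite: MajdaBertozziCUP2002, §1.4 eq. (1.33)] -/
theorem hasDerivWithinAt_integral_comp_vorticity
    (h : Torus.IsClassicalNSSolutionOn (Icc a b) ν f u p) (hab : a < b) (c : Fin 3) {β : ℝ → ℝ}
    (hβ : ContDiff ℝ ∞ β) {t : ℝ} (ht : t ∈ Icc a b) :
    HasDerivWithinAt (fun τ => ∫ x, β (torusVorticityTensor (u τ) (c + 1) (c + 2) x))
      (-ν * (∫ x, deriv (deriv β) (torusVorticityTensor (u t) (c + 1) (c + 2) x) *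
          ‖Torus.gradient (torusVorticityTensor (u t) (c + 1) (c + 2)) x‖ ^ 2) +
        ∫ x, deriv β (torusVorticityTensor (u t) (c + 1) (c + 2) x) *
          ((∑ k, torusVorticityTensor (u t) (k + 1) (k + 2) x * Torus.partialDeriv k (u t) x c) +
            (Torus.partialDeriv (c + 1) (f t) x (c + 2) - Torus.partialDeriv (c + 2) (f t) x (c + 1))))
      (Icc a b) t :=
  (h.isClassicalScalarTransportForcedOn_vorticity hab c).hasDerivWithinAt_integral_comp
    (convex_Icc a b) hβ ht

/-- The `L¹` form on `T³`: `∫ |ω_c(t)| − ∫ |ω_c(a)| ≤ ∫ₐᵗ ∫ |∑ₖ ωₖ∂ₖu_c + (∇ × f)_c|` (`ν ≥ 0`)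
— the componentwise analogue of Constantin's `L¹`-vorticity balance (1990, (2.7): growth of
`∫|ω|` only through the stretching term; tree `Torus.classicalNS_integral_vorticityAbs_le` for the
resulting a priori bound). [cite: Constantin1990, §2 (2.7)] -/
theorem integral_abs_vorticity_sub_le
    (h : Torus.IsClassicalNSSolutionOn (Icc a b) ν f u p) (hab : a < b) (hν : 0 ≤ ν) (c : Fin 3)
    {t : ℝ} (ht : t ∈ Icc a b) :
    (∫ x, |torusVorticityTensor (u t) (c + 1) (c + 2) x|) -
        (∫ x, |torusVorticityTensor (u a) (c + 1) (c + 2) x|) ≤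
      ∫ τ in a..t, ∫ x, |(∑ k, torusVorticityTensor (u τ) (k + 1) (k + 2) x * Torus.partialDeriv k (u τ) x c) +
        (Torus.partialDeriv (c + 1) (f τ) x (c + 2) - Torus.partialDeriv (c + 2) (f τ) x (c + 1))| :=
  (h.isClassicalScalarTransportForcedOn_vorticity hab c).integral_abs_sub_le hν Subset.rfl ht

/-- **On `T³` the co-signed flux of a vorticity component is raised only by the SIGNED
stretching–tilting (+ force-curl) source acting on the co-signed set `{ω_c > 0}`.** For a
classical solution of forced Navier–Stokes on `T³ × [a, b]` with `ν ≥ 0`, every `c ∈ Fin 3` and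
`t ∈ [a, b]`:
`∫_{T³} ω_c(t)⁺ − ∫_{T³} ω_c(a)⁺ ≤ ∫ₐᵗ ∫_{x : ω_c(τ, x) > 0} (∑ₖ ωₖ∂ₖu_c + (∇ × f)_c)(τ, x) dx dτ`
— sharpening `integral_posPart_vorticity_sub_le` (there: the positive part of the source over all
of `T³`): transport and viscosity contribute nothing positive, and stretching counts WITH ITS SIGN
and only where `ω_c` is already positive. Since `((ω·∇)u)_c = div(u_c ω)` has zero mean
(`integral_sum_torusVorticityTensor_mul_partialDeriv_eq_zero`), only its distribution across the
nodal surface `{ω_c = 0}` enters. MB (1.33) read as a forced passive scalar for `ω_c`, combined with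
the localised Kružkov / Crandall–Tartar estimate
`IsClassicalScalarTransportForcedOn.integral_posPart_sub_le_setIntegral` (Gallay–Wayne 2005,
Lemma 3.1, in the source-free planar case). The sign of the right-hand side is NOT controlled here.
[cite: GallayWayne2005, Lemma 3.1] -/
theorem integral_posPart_vorticity_sub_le_setIntegral
    (h : Torus.IsClassicalNSSolutionOn (Icc a b) ν f u p) (hab : a < b) (hν : 0 ≤ ν) (c : Fin 3)
    {t : ℝ} (ht : t ∈ Icc a b) :
    (∫ x, (torusVorticityTensor (u t) (c + 1) (c + 2) x)⁺) -
        (∫ x, (torusVorticityTensor (u a) (c + 1) (c + 2) x)⁺) ≤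
      ∫ τ in a..t, ∫ x in {x | 0 < torusVorticityTensor (u τ) (c + 1) (c + 2) x},
        ((∑ k, torusVorticityTensor (u τ) (k + 1) (k + 2) x * Torus.partialDeriv k (u τ) x c) +
          (Torus.partialDeriv (c + 1) (f τ) x (c + 2) - Torus.partialDeriv (c + 2) (f τ) x (c + 1))) :=
  (h.isClassicalScalarTransportForcedOn_vorticity hab c).integral_posPart_sub_le_setIntegral hν
    Subset.rfl ht

/-- The level form on `T³`: for every threshold `l` and `t ∈ [a, b]` (`ν ≥ 0`),
`∫ (ω_c(t) − l)⁺ − ∫ (ω_c(a) − l)⁺ ≤ ∫ₐᵗ ∫_{x : ω_c(τ, x) > l} (∑ₖ ωₖ∂ₖu_c + (∇ × f)_c)(τ, x) dx dτ`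
— the excess of a vorticity component over any threshold grows only through the signed source
acting inside the super-level set `{ω_c > l}` (the intense region itself). [cite: GallayWayne2005, Lemma 3.1] -/
theorem integral_posPart_vorticity_sub_sub_le_setIntegral
    (h : Torus.IsClassicalNSSolutionOn (Icc a b) ν f u p) (hab : a < b) (hν : 0 ≤ ν) (c : Fin 3)
    (l : ℝ) {t : ℝ} (ht : t ∈ Icc a b) :
    (∫ x, (torusVorticityTensor (u t) (c + 1) (c + 2) x - l)⁺) -
        (∫ x, (torusVorticityTensor (u a) (c + 1) (c + 2) x - l)⁺) ≤
      ∫ τ in a..t, ∫ x in {x | l < torusVorticityTensor (u τ) (c + 1) (c + 2) x},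
        ((∑ k, torusVorticityTensor (u τ) (k + 1) (k + 2) x * Torus.partialDeriv k (u τ) x c) +
          (Torus.partialDeriv (c + 1) (f τ) x (c + 2) - Torus.partialDeriv (c + 2) (f τ) x (c + 1))) :=
  (h.isClassicalScalarTransportForcedOn_vorticity hab c).integral_posPart_sub_sub_le_setIntegral hν l
    Subset.rfl ht

/-- The same for a force whose curl has vanishing `c`-component on `[a, b] × T³` (e.g. `f = 0` or a
gradient): `∫ ω_c(t)⁺ − ∫ ω_c(a)⁺ ≤ ∫ₐᵗ ∫_{ω_c(τ) > 0} ∑ₖ ωₖ∂ₖu_c` — the SIGNED stretching–tilting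
term over the co-signed set alone. [cite: GallayWayne2005, Lemma 3.1] -/
theorem integral_posPart_vorticity_sub_le_setIntegral_of_curlFree
    (h : Torus.IsClassicalNSSolutionOn (Icc a b) ν f u p) (hab : a < b) (hν : 0 ≤ ν) (c : Fin 3)
    (hf : ∀ τ ∈ Icc a b, ∀ x, Torus.partialDeriv (c + 1) (f τ) x (c + 2) = Torus.partialDeriv (c + 2) (f τ) x (c + 1))
    {t : ℝ} (ht : t ∈ Icc a b) :
    (∫ x, (torusVorticityTensor (u t) (c + 1) (c + 2) x)⁺) -
        (∫ x, (torusVorticityTensor (u a) (c + 1) (c + 2) x)⁺) ≤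
      ∫ τ in a..t, ∫ x in {x | 0 < torusVorticityTensor (u τ) (c + 1) (c + 2) x},
        ∑ k, torusVorticityTensor (u τ) (k + 1) (k + 2) x * Torus.partialDeriv k (u τ) x c := by
  have hmain := h.integral_posPart_vorticity_sub_le_setIntegral hab hν c ht
  have hta : Icc a t ⊆ Icc a b := Icc_subset_Icc le_rfl ht.2
  have e : ∫ τ in a..t, ∫ x in {x | 0 < torusVorticityTensor (u τ) (c + 1) (c + 2) x},
        ((∑ k, torusVorticityTensor (u τ) (k + 1) (k + 2) x * Torus.partialDeriv k (u τ) x c) +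
          (Torus.partialDeriv (c + 1) (f τ) x (c + 2) - Torus.partialDeriv (c + 2) (f τ) x (c + 1))) =
      ∫ τ in a..t, ∫ x in {x | 0 < torusVorticityTensor (u τ) (c + 1) (c + 2) x},
        ∑ k, torusVorticityTensor (u τ) (k + 1) (k + 2) x * Torus.partialDeriv k (u τ) x c := by
    refine intervalIntegral.integral_congr fun τ hτ => ?_
    rw [uIcc_of_le ht.1] at hτ
    refine integral_congr_ae (Filter.Eventually.of_forall fun x => ?_)
    dsimp only
    rw [hf τ (hta hτ) x, sub_self, add_zero]
  rw [e] at hmain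
  exact hmain

/-- **The source of a vorticity component has zero mean on `T³`.** Along a classical solution of
forced Navier–Stokes on `T³ × [a, b]` (`a < b`), for every `c ∈ Fin 3` and `τ ∈ [a, b]`:
`∫_{T³} (∑ₖ ωₖ∂ₖu_c + (∂_{c+1}f_{c+2} − ∂_{c+2}f_{c+1})) = 0` — the stretching–tilting term is a
divergence (`integral_sum_torusVorticityTensor_mul_partialDeriv_eq_zero`) and so is the curl of the
force — the periodic form of the conservation of the total flux of vorticity (Majda–Bertozzi
2002, §1.7 Prop. 1.12 (i), eq. (1.65); on `T³` that flux `∫ ω_c` is moreover zero). Consistently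
`∫ ω_c⁺ = ∫ ω_c⁻` at all times, and the bound of `integral_posPart_vorticity_sub_le_setIntegral`
equals minus the source integrated over the counter-signed set `{ω_c ≤ 0}`. [cite: MajdaBertozziCUP2002, §1.7 Prop. 1.12 eq. (1.65)] -/
theorem integral_vorticitySource_eq_zero
    (h : Torus.IsClassicalNSSolutionOn (Icc a b) ν f u p) (hab : a < b) (c : Fin 3) {τ : ℝ}
    (hτ : τ ∈ Icc a b) :
    ∫ x, ((∑ k, torusVorticityTensor (u τ) (k + 1) (k + 2) x * Torus.partialDeriv k (u τ) x c) +
        (Torus.partialDeriv (c + 1) (f τ) x (c + 2) - Torus.partialDeriv (c + 2) (f τ) x (c + 1))) = 0 := by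
  have hU : UniqueDiffOn ℝ (Icc a b) := uniqueDiffOn_Icc hab
  have hu : Torus.IsSmooth (u τ) := h.smooth_velocity.isSmooth_slice hτ
  have hfτ : Torus.IsSmooth (f τ) := (isSmoothSpaceTimeOn_force' h hU).isSmooth_slice hτ
  have hf1 : Torus.IsContDiff 1 (f τ) := hfτ.isContDiff (by simp)
  have hW : ∀ k : Fin 3, Torus.IsSmooth (torusVorticityTensor (u τ) (k + 1) (k + 2)) := fun k =>
    (((hu.partialDeriv (k + 1)).apply (k + 2)).sub ((hu.partialDeriv (k + 2)).apply (k + 1)))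
  have hsK : ∀ k : Fin 3, Torus.IsSmooth (fun x =>
      torusVorticityTensor (u τ) (k + 1) (k + 2) x * Torus.partialDeriv k (u τ) x c) :=
    fun k => ContDiff.mul (hW k) ((hu.partialDeriv k).apply c)
  have iS : Integrable (fun x => ∑ k, torusVorticityTensor (u τ) (k + 1) (k + 2) x *
      Torus.partialDeriv k (u τ) x c) (volume : Measure (UnitAddTorus (Fin 3))) :=
    integrable_finsetSum _ fun k _ => (hsK k).integrable
  have iF1 : Integrable (fun x => Torus.partialDeriv (c + 1) (f τ) x (c + 2))
      (volume : Measure (UnitAddTorus (Fin 3))) := ((hfτ.partialDeriv (c + 1)).apply (c + 2)).integrable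
  have iF2 : Integrable (fun x => Torus.partialDeriv (c + 2) (f τ) x (c + 1))
      (volume : Measure (UnitAddTorus (Fin 3))) := ((hfτ.partialDeriv (c + 2)).apply (c + 1)).integrable
  have iF : Integrable (fun x => Torus.partialDeriv (c + 1) (f τ) x (c + 2) -
      Torus.partialDeriv (c + 2) (f τ) x (c + 1)) (volume : Measure (UnitAddTorus (Fin 3))) :=
    iF1.sub iF2
  have hF : ∀ m n : Fin 3, ∫ x, Torus.partialDeriv m (f τ) x n = 0 := fun m n => by
    have h0 := Torus.integral_partialDeriv_eq_zero_holds (hfτ.apply n) m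
    simpa only [Torus.partialDeriv_apply_coord hf1] using h0
  rw [integral_add iS iF, integral_sub iF1 iF2,
    integral_sum_torusVorticityTensor_mul_partialDeriv_eq_zero hu c, hF, hF]
  ring


end Literature.Analysis.FunctionSpaces.Torus.IsClassicalNSSolutionOn
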